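import Summits.Ventures.PercRepro.PuncturedLYMPaving
import Summits.Ventures.PercRepro.PuncturedLYMCoHypIn

/-!
# PercRepro — THE PAVING BRIDGE AND THE ONE-HYPERPLANE THEOREM ON AN ARBITRARY GROUND SET (p10, gen 34)

PuncturedLYMPaving and PuncturedLYMCoHypMain (gen 33) were stated for `gr M = univ`.  With (SP) for the `j`-subsets of
a finset containing a set `C` (PuncturedLYMCoHypIn) the restriction disappears, exactly as gen 31 removed it for sparse
paving matroids:
* `biIndepSets_eq_puncturedIn_of_paving`, `biIndepSets_succ_eq_powersetCard_of_paving` — at the bottom level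
  `j = n − r` (`n + 2 ≤ 2r`) the bi-independent `j`-sets of a paving matroid are the punctured level of its co-code
  inside `gr M`, and every `(j+1)`-subset of `gr M` is bi-independent;
* **`normConsStep_bottom_of_puncturedNMPIn_of_paving`**, **`normConsAt_of_paving_of_puncturedNMPIn`** — the paving
  bridge inside `gr M`: (NC) for every paving matroid with `r + 1 ≤ n ≤ 2r − 2` whose co-code has the punctured
  normalised matching property inside `gr M`;
* `cocode_eq_upLevelIn` — when the dependent `r`-sets are exactly the `r`-subsets of `H`, the co-code is the family of
  `(n − r)`-subsets of `gr M` containing `gr M ∖ H`;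
* `IsOneHyperplaneF M r H` — a paving matroid of rank `r` whose dependent `r`-sets are exactly the `r`-subsets of a
  proper subset `H` of the ground set (at most one nontrivial hyperplane; `#H < r` gives the uniform matroid);
* **`normConsAt_of_oneHyperplane'`** — **(NC) for every such matroid with `r + 1 ≤ n ≤ 2r − 2`, on any ground set**
  (uniform when `#H < r`, the one-co-hyperplane theorem inside `gr M` otherwise).
Nothing here asserts (SP), (PAV) or (NC) in general.
-/

open scoped Matroid

namespace PercRepro.Cogirth

open Finset ThmH Skew

variable {α : Type} [DecidableEq α] {M : Matroid α} [M.Finite]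

/-- The bi-independent `(n − r)`-sets of a paving matroid are the punctured level of the co-code inside `gr M`
(`n + 2 ≤ 2r`). -/
theorem biIndepSets_eq_puncturedIn_of_paving {r : ℕ} (hp : IsPaving M) (hrk : rk M (gr M) = r)
    (hn : (gr M).card + 2 ≤ 2 * r) :
    biIndepSets M ((gr M).card - r) = PuncturedLYM.puncturedIn ((gr M).card - r) (gr M) (cocode M r) := by
  ext X
  rw [mem_biIndepSets, PuncturedLYM.puncturedIn, mem_sdiff, mem_powersetCard, mem_cocode]
  constructor
  · rintro ⟨hXg, hXc, -, hXd⟩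
    refine ⟨⟨hXg, hXc⟩, ?_⟩
    rintro ⟨-, h⟩
    exact h hXd
  · rintro ⟨⟨hXg, hXc⟩, hXD⟩
    refine ⟨hXg, hXc, rk_eq_card_of_card_lt_of_paving hp hrk hXg (by omega), ?_⟩
    by_contra h
    exact hXD ⟨⟨hXg, hXc⟩, h⟩

/-- The bi-independent `(n − r + 1)`-sets of a paving matroid are all the `(n − r + 1)`-subsets of `gr M`
(`n + 2 ≤ 2r`). -/
theorem biIndepSets_succ_eq_powersetCard_of_paving {r : ℕ} (hp : IsPaving M) (hrk : rk M (gr M) = r)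
    (hn : (gr M).card + 2 ≤ 2 * r) :
    biIndepSets M ((gr M).card - r + 1) = (gr M).powersetCard ((gr M).card - r + 1) := by
  have hr : r ≤ (gr M).card := by
    have := hrk ▸ rk_le_card (gr M)
    omega
  apply biIndepSets_eq_powersetCard_of_indep_of_indep
  · intro S hS hSc
    exact rk_eq_card_of_card_lt_of_paving hp hrk hS (by omega)
  · intro S hS hSc
    exact rk_eq_card_of_card_lt_of_paving hp hrk hS (by omega)

/-- **The bottom step of (NC) for a paving matroid follows from the punctured normalised matching property of its
co-code inside `gr M`** (`n + 2 ≤ 2r`). -/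
theorem normConsStep_bottom_of_puncturedNMPIn_of_paving {r : ℕ} (hp : IsPaving M) (hrk : rk M (gr M) = r)
    (hn : (gr M).card + 2 ≤ 2 * r) {U : Finset (Finset α)} (hU : UpFlats M U)
    (hSP : PuncturedLYM.PuncturedNMPIn ((gr M).card - r) (gr M) (cocode M r)) :
    NormConsStep M U ((gr M).card - r) := by
  set j := (gr M).card - r with hj
  unfold NormConsStep upCount
  rw [biIndepSets_eq_puncturedIn_of_paving hp hrk hn, biIndepSets_succ_eq_powersetCard_of_paving hp hrk hn]
  set P := PuncturedLYM.puncturedIn j (gr M) (cocode M r) with hP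
  set 𝒜 := P.filter (fun X => X ∈ U) with h𝒜
  have h𝒜P : 𝒜 ⊆ P := filter_subset _ _
  have hbot : P.filter (fun X => clF M X ∈ U) = 𝒜 := by
    apply filter_congr
    intro X hX
    rw [hP, PuncturedLYM.puncturedIn, mem_sdiff, mem_powersetCard] at hX
    rw [clF_eq_self_of_card_eq_of_paving hp hrk hn hX.1.1 hX.1.2]
  rw [hbot]
  have hup : PuncturedLYM.upNbhdIn j (gr M) 𝒜 ⊆
      ((gr M).powersetCard (j + 1)).filter (fun Y => clF M Y ∈ U) := by
    intro Y hY
    rw [PuncturedLYM.upNbhdIn, mem_filter, mem_powersetCard] at hY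
    obtain ⟨⟨hYg, hYc⟩, X, hX𝒜, hXY⟩ := hY
    rw [mem_filter, mem_powersetCard]
    refine ⟨⟨hYg, hYc⟩, ?_⟩
    have hXU : X ∈ U := (mem_filter.1 hX𝒜).2
    have hXcl : X ⊆ clF M Y := hXY.trans (subset_clF_fu hYg)
    exact hU.up X hXU (clF M Y) (isFlatF_clF Y) hXcl
  have h1 := hSP 𝒜 h𝒜P
  have h2 := card_le_card hup
  rw [card_powersetCard]
  calc 𝒜.card * (gr M).card.choose (j + 1)
      ≤ (PuncturedLYM.upNbhdIn j (gr M) 𝒜).card * P.card := h1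
    _ ≤ (((gr M).powersetCard (j + 1)).filter (fun Y => clF M Y ∈ U)).card * P.card :=
        Nat.mul_le_mul_right _ h2

/-- **THE PAVING BRIDGE ON ANY GROUND SET**: (NC) holds for every paving matroid with `r + 1 ≤ n` and `n + 2 ≤ 2r`
whose co-code has the punctured normalised matching property inside `gr M`. -/
theorem normConsAt_of_paving_of_puncturedNMPIn {r : ℕ} (hp : IsPaving M) (hrk : rk M (gr M) = r)
    (hr1 : r + 1 ≤ (gr M).card) (hn : (gr M).card + 2 ≤ 2 * r)
    (hSP : PuncturedLYM.PuncturedNMPIn ((gr M).card - r) (gr M) (cocode M r)) : NormConsAt M := by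
  intro U hU j
  rcases Nat.lt_or_ge j ((gr M).card - r) with hlt | hge
  · apply normConsStep_of_lt
    rw [hrk]
    omega
  rcases Nat.eq_or_lt_of_le hge with heq | hgt
  · rw [← heq]
    exact normConsStep_bottom_of_puncturedNMPIn_of_paving hp hrk hn hU hSP
  rcases Nat.lt_or_ge (j + 1) r with hmid | htop
  · apply normConsStep_of_indep_succ_of_indep_sdiff hU (by omega)
    · intro S hS hSc
      exact rk_eq_card_of_card_lt_of_paving hp hrk hS (by omega)
    · intro S hS hSc
      exact rk_eq_card_of_card_lt_of_paving hp hrk hS (by omega)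
  · apply normConsStep_of_rk_le hU
    rw [hrk]
    omega

/-- If the dependent `r`-subsets of `gr M` are exactly the `r`-subsets of `H` (`r ≤ n`), the co-code is the family of
`(n − r)`-subsets of `gr M` containing `gr M ∖ H`. -/
theorem cocode_eq_upLevelIn {r : ℕ} (hr : r ≤ (gr M).card) {H : Finset α}
    (hH : ∀ S ⊆ gr M, S.card = r → (rk M S ≠ S.card ↔ S ⊆ H)) :
    cocode M r = PuncturedLYM.upLevelIn ((gr M).card - r) (gr M) (gr M \ H) := by
  ext X
  rw [mem_cocode, PuncturedLYM.mem_upLevelIn]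
  constructor
  · rintro ⟨⟨hXg, hXc⟩, hdep⟩
    refine ⟨⟨hXg, hXc⟩, ?_⟩
    have hSc : (gr M \ X).card = r := by
      rw [card_sdiff_of_subset hXg, hXc]
      omega
    have hSH : gr M \ X ⊆ H := (hH _ sdiff_subset hSc).1 hdep
    intro z hz
    rw [mem_sdiff] at hz
    by_contra hzX
    have hz' : z ∈ gr M \ X := mem_sdiff.2 ⟨hz.1, hzX⟩
    exact hz.2 (hSH hz')
  · rintro ⟨⟨hXg, hXc⟩, hHX⟩
    refine ⟨⟨hXg, hXc⟩, ?_⟩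
    have hSc : (gr M \ X).card = r := by
      rw [card_sdiff_of_subset hXg, hXc]
      omega
    apply (hH _ sdiff_subset hSc).2
    intro z hz
    rw [mem_sdiff] at hz
    by_contra hzH
    have hz' : z ∈ gr M \ H := mem_sdiff.2 ⟨hz.1, hzH⟩
    exact hz.2 (hHX hz')

/-- **A paving matroid with at most one nontrivial hyperplane**: rank `r`, every set with fewer than `r` elements
independent, and the dependent `r`-subsets of the ground set are exactly the `r`-subsets of a proper subset `H` of the
ground set (`#H < r`: no dependent `r`-set, the uniform matroid; `#H ≥ r`: `H` is the unique nontrivial hyperplane). -/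
def IsOneHyperplaneF (M : Matroid α) [M.Finite] (r : ℕ) (H : Finset α) : Prop :=
  rk M (gr M) = r ∧ IsPaving M ∧ H ⊆ gr M ∧ H.card < (gr M).card ∧
    ∀ S ⊆ gr M, S.card = r → (rk M S ≠ S.card ↔ S ⊆ H)

omit [DecidableEq α] in
/-- A one-hyperplane matroid with `#H < r` is uniform. -/
theorem isUniformF_of_oneHyperplane_of_card_lt {r : ℕ} {H : Finset α} (h1 : IsOneHyperplaneF M r H)
    (hsmall : H.card < r) : IsUniformF M := by
  obtain ⟨hrk, hp, -, -, hH⟩ := h1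
  intro S hS hSc
  rw [hrk] at hSc
  rcases Nat.lt_or_ge S.card r with hlt | hge
  · exact rk_eq_card_of_card_lt_of_paving hp hrk hS (by omega)
  · have hSr : S.card = r := le_antisymm hSc hge
    by_contra hne
    have hSH := card_le_card ((hH S hS hSr).1 hne)
    omega

/-- **(NC) FOR EVERY PAVING MATROID WITH AT MOST ONE NONTRIVIAL HYPERPLANE, ON ANY GROUND SET**, with
`r + 1 ≤ n ≤ 2r − 2`: uniform when `#H < r`; otherwise the co-code is `upLevelIn (n − r) (gr M) (gr M ∖ H)` with
`1 ≤ #(gr M ∖ H) ≤ n − r` and `2(n − r) + 1 ≤ n`, and the one-co-hyperplane theorem inside `gr M` feeds the paving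
bridge. -/
theorem normConsAt_of_oneHyperplane' {r : ℕ} {H : Finset α} (h1 : IsOneHyperplaneF M r H)
    (hr1 : r + 1 ≤ (gr M).card) (hn : (gr M).card + 2 ≤ 2 * r) : NormConsAt M := by
  rcases Nat.lt_or_ge H.card r with hsmall | hrH
  · exact normConsAt_of_uniform (isUniformF_of_oneHyperplane_of_card_lt h1 hsmall)
  · obtain ⟨hrk, hp, hHg, hHn, hH⟩ := h1
    apply normConsAt_of_paving_of_puncturedNMPIn hp hrk hr1 hn
    rw [cocode_eq_upLevelIn (by omega) hH]
    apply PuncturedLYM.puncturedNMP_in_upLevel sdiff_subset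
    · rw [card_sdiff_of_subset hHg]
      omega
    · rw [card_sdiff_of_subset hHg]
      omega
    · omega

end PercRepro.Cogirth
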